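import Summits.CriticalPhenomena.PercolationContinuityZ3.Theorems.PercNearOneGluingAdditiveGluingFullTieReduction
import Literature.Probability.Percolation.KozmaNitzanPreFKG
import HarnessLib

/-!
# Crux `PercNearOneGluing.AdditiveGluing` (stmt-CriticalPhenomena-4576): tools for the TWO-STEP GLUING reduction of the
# three-relay case (weighted Kozma–Nitzan Theorem 1; pull-backs along a glued pair)

Support file (`--supports stmt-CriticalPhenomena-4576`; task png-dp-al5, memo `TWOSTEP-GLUE.md` on the item); no definitions, no named
facts, no sorries.  Used by `…AdditiveGluingTwoStepGlue.lean` (the reduction CAG(3) ⟸ (★★)).  Notation: `μ = prodBernoulli u` on the bond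
configurations of the weighted complete graph `Fin n`, `{x ↔ y} = openConn x y`; the glued pair is `{a₁, a₂}`,
`μ¹ = μ_{w[s(a₁,a₂) ↦ 1]}` = pushforward of `μ_w` under `ω ↦ ω ∪ {s(a₁,a₂)}` (`fullTie_real_update_one`, `fullTie_glueReach_pair`).

* `twoStep_thm1_weighted` — Kozma–Nitzan's Theorem 1 in its WEIGHTED form (6): for relays `x ≠ y`, `D = {x ↮ y}`,
  `E = {o↔b} ∩ (o↔x ∪ o↔y)`, `F_z = (o↔x ∪ o↔y) ∩ {z↔b}`:  `μ(D ∩ o↔x)·(μE − μF_x) + μ(D ∩ o↔y)·(μE − μF_y) ≥ 0`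
  ("BHK four times", the proof of the landed `KNPreFKG.preFKG_pair` with the weights kept);
* `twoStep_EF_identity` — `μE − μF_x = T_y − Gain` (event bookkeeping);
* `twoStep_glueReach_left/right`, `twoStep_glue_psi12/psic/gain/Tc/Ta` — the `μ¹`-probabilities entering the weighted Theorem 1 for
  the relays `a₁` (glued class) and `c`, written as `μ_w`-probabilities of explicit events.
[cite: KozmaNitzan2024, Theorem 1 and (6) (pp. 7–8)] [cite: VandenbergHaggstromKahn2005, Thms. 1.3–1.4 (pp. 6–7)]
-/

namespace Summit.CriticalPhenomena.PercolationContinuityZ3.Theorems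

open MeasureTheory Set Literature.Probability.LatticeModels Literature.Probability.Percolation

noncomputable section
open Classical

variable {n : ℕ}

/-! ### Kozma–Nitzan's Theorem 1 in weighted form -/

/-- **Kozma–Nitzan Theorem 1, weighted form (6).**  For every weighting `u`, observer `o`, target `b` and relays `x ≠ y`,
with `D = {x ↮ y}`, `E = {o↔b} ∩ ({o↔x} ∪ {o↔y})`, `F_z = ({o↔x} ∪ {o↔y}) ∩ {z↔b}`:
`μ(D ∩ o↔x)·(μ(E) − μ(F_x)) + μ(D ∩ o↔y)·(μ(E) − μ(F_y)) ≥ 0`.  ("BHK four times", as in the printed proof.)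
[cite: KozmaNitzan2024, Theorem 1, eq. (6) (pp. 7–8)] [cite: VandenbergHaggstromKahn2005, Thms. 1.3–1.4] -/
theorem twoStep_thm1_weighted (u : Sym2 (Fin n) → unitInterval) (o b x y : Fin n) (hxy : x ≠ y) :
    0 ≤ (prodBernoulli u).real ((openConn x y)ᶜ ∩ openConn o x) *
        ((prodBernoulli u).real (openConn o b ∩ (openConn o x ∪ openConn o y)) -
          (prodBernoulli u).real ((openConn o x ∪ openConn o y) ∩ openConn x b)) +
      (prodBernoulli u).real ((openConn x y)ᶜ ∩ openConn o y) *
        ((prodBernoulli u).real (openConn o b ∩ (openConn o x ∪ openConn o y)) -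
          (prodBernoulli u).real ((openConn o x ∪ openConn o y) ∩ openConn y b)) := by
  set μ := prodBernoulli u with hμ
  set O₁ : Set (BondConfig (Fin n)) := openConn o x with hO₁
  set O₂ : Set (BondConfig (Fin n)) := openConn o y with hO₂
  set Ob : Set (BondConfig (Fin n)) := openConn o b with hOb
  set B₁ : Set (BondConfig (Fin n)) := openConn x b with hB₁
  set B₂ : Set (BondConfig (Fin n)) := openConn y b with hB₂
  set D : Set (BondConfig (Fin n)) := {ω | ¬ (openGraph ω).Reachable x y} with hD
  set E : Set (BondConfig (Fin n)) := Ob ∩ (O₁ ∪ O₂) with hE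
  set F₁ : Set (BondConfig (Fin n)) := (O₁ ∪ O₂) ∩ B₁ with hF₁
  set F₂ : Set (BondConfig (Fin n)) := (O₁ ∪ O₂) ∩ B₂ with hF₂
  have hDc : ((openConn x y)ᶜ : Set (BondConfig (Fin n))) = D := by
    ext ω
    simp only [mem_compl_iff, openConn, mem_setOf_eq, hD]
  rw [hDc]
  have hsplit : ∀ A S : Set (BondConfig (Fin n)), μ.real A = μ.real (A ∩ S) + μ.real (A ∩ Sᶜ) := by
    intro A S
    rw [← measureReal_inter_add_sdiff (s := A) (MeasurableSet.of_discrete : MeasurableSet S), Set.sdiff_eq]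
  have hE1 : E ∩ O₁ = F₁ ∩ O₁ := by
    ext ω
    simp only [mem_inter_iff, mem_union, hE, hF₁, hO₁, hO₂, hOb, hB₁, openConn, mem_setOf_eq]
    constructor
    · rintro ⟨⟨hb, _⟩, h1⟩
      exact ⟨⟨Or.inl h1, h1.symm.trans hb⟩, h1⟩
    · rintro ⟨⟨_, hb⟩, h1⟩
      exact ⟨⟨h1.trans hb, Or.inl h1⟩, h1⟩
  have hE1c : E ∩ O₁ᶜ = O₂ ∩ B₂ ∩ D := by
    ext ω
    simp only [mem_inter_iff, mem_union, mem_compl_iff, hE, hO₁, hO₂, hOb, hB₂, hD, openConn, mem_setOf_eq]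
    constructor
    · rintro ⟨⟨hb, h1 | h2⟩, hn1⟩
      · exact absurd h1 hn1
      · exact ⟨⟨h2, h2.symm.trans hb⟩, fun h => hn1 (h2.trans h.symm)⟩
    · rintro ⟨⟨h2, hb⟩, hn⟩
      exact ⟨⟨h2.trans hb, Or.inr h2⟩, fun h1 => hn (h1.symm.trans h2)⟩
  have hF1c : F₁ ∩ O₁ᶜ = O₂ ∩ B₁ ∩ D := by
    ext ω
    simp only [mem_inter_iff, mem_union, mem_compl_iff, hF₁, hO₁, hO₂, hB₁, hD, openConn, mem_setOf_eq]
    constructor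
    · rintro ⟨⟨h1 | h2, hb⟩, hn1⟩
      · exact absurd h1 hn1
      · exact ⟨⟨h2, hb⟩, fun h => hn1 (h2.trans h.symm)⟩
    · rintro ⟨⟨h2, hb⟩, hn⟩
      exact ⟨⟨Or.inr h2, hb⟩, fun h1 => hn (h1.symm.trans h2)⟩
  have hE2 : E ∩ O₂ = F₂ ∩ O₂ := by
    ext ω
    simp only [mem_inter_iff, mem_union, hE, hF₂, hO₁, hO₂, hOb, hB₂, openConn, mem_setOf_eq]
    constructor
    · rintro ⟨⟨hb, _⟩, h2⟩
      exact ⟨⟨Or.inr h2, h2.symm.trans hb⟩, h2⟩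
    · rintro ⟨⟨_, hb⟩, h2⟩
      exact ⟨⟨h2.trans hb, Or.inr h2⟩, h2⟩
  have hE2c : E ∩ O₂ᶜ = O₁ ∩ B₁ ∩ D := by
    ext ω
    simp only [mem_inter_iff, mem_union, mem_compl_iff, hE, hO₁, hO₂, hOb, hB₁, hD, openConn, mem_setOf_eq]
    constructor
    · rintro ⟨⟨hb, h1 | h2⟩, hn2⟩
      · exact ⟨⟨h1, h1.symm.trans hb⟩, fun h => hn2 (h1.trans h)⟩
      · exact absurd h2 hn2
    · rintro ⟨⟨h1, hb⟩, hn⟩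
      exact ⟨⟨h1.trans hb, Or.inl h1⟩, fun h2 => hn (h1.symm.trans h2)⟩
  have hF2c : F₂ ∩ O₂ᶜ = O₁ ∩ B₂ ∩ D := by
    ext ω
    simp only [mem_inter_iff, mem_union, mem_compl_iff, hF₂, hO₁, hO₂, hB₂, hD, openConn, mem_setOf_eq]
    constructor
    · rintro ⟨⟨h1 | h2, hb⟩, hn2⟩
      · exact ⟨⟨h1, hb⟩, fun h => hn2 (h1.trans h)⟩
      · exact absurd h2 hn2
    · rintro ⟨⟨h1, hb⟩, hn⟩
      exact ⟨⟨Or.inl h1, hb⟩, fun h2 => hn (h1.symm.trans h2)⟩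
  have hdiff1 : μ.real E - μ.real F₁ = μ.real (O₂ ∩ B₂ ∩ D) - μ.real (O₂ ∩ B₁ ∩ D) := by
    rw [hsplit E O₁, hsplit F₁ O₁, hE1, hE1c, hF1c]
    ring
  have hdiff2 : μ.real E - μ.real F₂ = μ.real (O₁ ∩ B₁ ∩ D) - μ.real (O₁ ∩ B₂ ∩ D) := by
    rw [hsplit E O₂, hsplit F₂ O₂, hE2, hE2c, hF2c]
    ring
  -- "Applying BHK 4 times", given `D = {x ↮ y}`
  have hD1 : {ω : BondConfig (Fin n) | ∀ z ∈ ({y} : Set (Fin n)), ¬ (openGraph ω).Reachable x z} = D := by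
    ext ω
    simp [hD]
  have hD2 : {ω : BondConfig (Fin n) | ∀ z ∈ ({x} : Set (Fin n)), ¬ (openGraph ω).Reachable y z} = D := by
    ext ω
    simp only [mem_setOf_eq, mem_singleton_iff, forall_eq, hD]
    exact not_congr ⟨SimpleGraph.Reachable.symm, SimpleGraph.Reachable.symm⟩
  have hD3 : {ω : BondConfig (Fin n) | ¬ (openGraph ω).Reachable y x} = D := by
    ext ω
    simp only [mem_setOf_eq, hD]
    exact not_congr ⟨SimpleGraph.Reachable.symm, SimpleGraph.Reachable.symm⟩
  have h_i := KNPreFKG.bhk_one_upper_upper u y ({x} : Set (Fin n)) (by simpa using Ne.symm hxy)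
    (KNPreFKG.isUpperSet_connFamily y o) (KNPreFKG.isUpperSet_connFamily y b)
  rw [hD2, ← KNPreFKG.openConn_eq_setOf_connFamily, ← KNPreFKG.openConn_eq_setOf_connFamily,
    KNPreFKG.openConn_symm y o] at h_i
  have h_ii := KNPreFKG.bhk_two_upper_upper u y x (Ne.symm hxy) (KNPreFKG.isUpperSet_connFamily y o)
    (KNPreFKG.isUpperSet_connFamily x b)
  rw [hD3, ← KNPreFKG.openConn_eq_setOf_connFamily, ← KNPreFKG.openConn_eq_setOf_connFamily,
    KNPreFKG.openConn_symm y o] at h_ii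
  have h_iii := KNPreFKG.bhk_one_upper_upper u x ({y} : Set (Fin n)) (by simpa using hxy)
    (KNPreFKG.isUpperSet_connFamily x o) (KNPreFKG.isUpperSet_connFamily x b)
  rw [hD1, ← KNPreFKG.openConn_eq_setOf_connFamily, ← KNPreFKG.openConn_eq_setOf_connFamily,
    KNPreFKG.openConn_symm x o] at h_iii
  have h_iv := KNPreFKG.bhk_two_upper_upper u x y hxy (KNPreFKG.isUpperSet_connFamily x o)
    (KNPreFKG.isUpperSet_connFamily y b)
  rw [← KNPreFKG.openConn_eq_setOf_connFamily, ← KNPreFKG.openConn_eq_setOf_connFamily,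
    KNPreFKG.openConn_symm x o] at h_iv
  have e1 : D ∩ (O₂ ∩ B₂) = O₂ ∩ B₂ ∩ D := inter_comm _ _
  have e2 : D ∩ (O₂ ∩ B₁) = O₂ ∩ B₁ ∩ D := inter_comm _ _
  have e3 : D ∩ (O₁ ∩ B₁) = O₁ ∩ B₁ ∩ D := inter_comm _ _
  have e4 : D ∩ (O₁ ∩ B₂) = O₁ ∩ B₂ ∩ D := inter_comm _ _
  simp only [← hD, ← hO₁, ← hO₂, ← hB₁, ← hB₂] at h_i h_ii h_iii h_iv
  rw [e1] at h_i
  rw [e2] at h_ii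
  rw [e3] at h_iii
  rw [e4] at h_iv
  -- combine: `μ(D)·[ψ₁(μE − μF₁) + ψ₂(μE − μF₂)] ≥ 0`
  have hψ1 : 0 ≤ μ.real (D ∩ O₁) := measureReal_nonneg
  have hψ2 : 0 ≤ μ.real (D ∩ O₂) := measureReal_nonneg
  by_cases hD0 : μ.real D = 0
  · have hz : ∀ A : Set (BondConfig (Fin n)), μ.real (D ∩ A) = 0 := fun A =>
      le_antisymm ((measureReal_mono inter_subset_left (measure_ne_top _ _)).trans hD0.le) measureReal_nonneg
    rw [hz, hz]
    simp
  · have hDpos : 0 < μ.real D := lt_of_le_of_ne measureReal_nonneg (Ne.symm hD0)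
    have key1 : μ.real D * (μ.real E - μ.real F₁) ≥
        μ.real (D ∩ O₂) * (μ.real (D ∩ B₂) - μ.real (D ∩ B₁)) := by
      rw [hdiff1, mul_sub]
      nlinarith [h_i, h_ii]
    have key2 : μ.real D * (μ.real E - μ.real F₂) ≥
        μ.real (D ∩ O₁) * (μ.real (D ∩ B₁) - μ.real (D ∩ B₂)) := by
      rw [hdiff2, mul_sub]
      nlinarith [h_iii, h_iv]
    have key : μ.real D * (μ.real (D ∩ O₁) * (μ.real E - μ.real F₁) +
        μ.real (D ∩ O₂) * (μ.real E - μ.real F₂)) ≥ 0 := by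
      have k1 := mul_le_mul_of_nonneg_left key1.le hψ1
      have k2 := mul_le_mul_of_nonneg_left key2.le hψ2
      nlinarith [k1, k2]
    exact nonneg_of_mul_nonneg_right key hDpos

/-! ### Pull-backs along the glued pair `{a₁, a₂}` (`μ¹ = μ_{w[s(a₁,a₂) ↦ 1]}`, pushforward `ω ↦ ω ∪ {s(a₁,a₂)}`) -/

section GluePair

/-- After gluing `{a₁, a₂}`: `a₁ ↔ y` iff `a₁ ↔ y` or `a₂ ↔ y` before. [folklore] -/
theorem twoStep_glueReach_left (a₁ a₂ y : Fin n) (ω : BondConfig (Fin n)) :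
    (ω ∪ {e | (∀ z ∈ e, z ∈ ({a₁, a₂} : Finset (Fin n))) ∧ ¬ e.IsDiag}) ∈ (openConn a₁ y : Set (BondConfig (Fin n))) ↔
      (ω ∈ (openConn a₁ y : Set (BondConfig (Fin n))) ∨ ω ∈ (openConn a₂ y : Set (BondConfig (Fin n)))) := by
  rw [fullTie_glueReach_pair]
  have h11 := fullTie_mem_openConn_self a₁ ω
  tauto

/-- After gluing `{a₁, a₂}`: `x ↔ a₁` iff `x ↔ a₁` or `x ↔ a₂` before. [folklore] -/
theorem twoStep_glueReach_right (a₁ a₂ x : Fin n) (ω : BondConfig (Fin n)) :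
    (ω ∪ {e | (∀ z ∈ e, z ∈ ({a₁, a₂} : Finset (Fin n))) ∧ ¬ e.IsDiag}) ∈ (openConn x a₁ : Set (BondConfig (Fin n))) ↔
      (ω ∈ (openConn x a₁ : Set (BondConfig (Fin n))) ∨ ω ∈ (openConn x a₂ : Set (BondConfig (Fin n)))) := by
  rw [fullTie_glueReach_pair]
  have h11 := fullTie_mem_openConn_self a₁ ω
  have hs : ω ∈ (openConn a₂ a₁ : Set (BondConfig (Fin n))) → ω ∈ (openConn x a₂ : Set (BondConfig (Fin n))) →
      ω ∈ (openConn x a₁ : Set (BondConfig (Fin n))) := fun h h' => SimpleGraph.Reachable.trans h' h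
  tauto

/-- `μ¹({a₁ ↮ c} ∩ {o ↔ a₁}) = μ(N ∩ (o↔a₁ ∪ o↔a₂))`, `N = {c ↮ a₁} ∩ {c ↮ a₂}`. [folklore] -/
theorem twoStep_glue_psi12 (w : Sym2 (Fin n) → unitInterval) {a₁ a₂ : Fin n} (h12 : a₁ ≠ a₂) (o c : Fin n) :
    (prodBernoulli (Function.update w s(a₁, a₂) 1)).real ((openConn a₁ c)ᶜ ∩ openConn o a₁) =
      (prodBernoulli w).real ((openConn c a₁)ᶜ ∩ (openConn c a₂)ᶜ ∩ (openConn o a₁ ∪ openConn o a₂) :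
        Set (BondConfig (Fin n))) := by
  rw [fullTie_real_update_one w h12]
  congr 1
  ext ω
  simp only [Set.mem_setOf_eq, Set.mem_inter_iff, Set.mem_compl_iff, Set.mem_union]
  rw [fullTie_glueReach_pair, fullTie_glueReach_pair]
  have h11 := fullTie_mem_openConn_self a₁ ω
  have hs1 : ω ∈ (openConn a₁ c : Set (BondConfig (Fin n))) ↔ ω ∈ (openConn c a₁ : Set (BondConfig (Fin n))) :=
    ⟨fun h => SimpleGraph.Reachable.symm h, fun h => SimpleGraph.Reachable.symm h⟩
  have hs2 : ω ∈ (openConn a₂ c : Set (BondConfig (Fin n))) ↔ ω ∈ (openConn c a₂ : Set (BondConfig (Fin n))) :=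
    ⟨fun h => SimpleGraph.Reachable.symm h, fun h => SimpleGraph.Reachable.symm h⟩
  tauto

/-- `μ¹({a₁ ↮ c} ∩ {o ↔ c}) = μ(N ∩ o↔c)`. [folklore] -/
theorem twoStep_glue_psic (w : Sym2 (Fin n) → unitInterval) {a₁ a₂ : Fin n} (h12 : a₁ ≠ a₂) (o c : Fin n) :
    (prodBernoulli (Function.update w s(a₁, a₂) 1)).real ((openConn a₁ c)ᶜ ∩ openConn o c) =
      (prodBernoulli w).real ((openConn c a₁)ᶜ ∩ (openConn c a₂)ᶜ ∩ openConn o c : Set (BondConfig (Fin n))) := by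
  rw [fullTie_real_update_one w h12]
  congr 1
  ext ω
  simp only [Set.mem_setOf_eq, Set.mem_inter_iff, Set.mem_compl_iff]
  rw [fullTie_glueReach_pair, fullTie_glueReach_pair]
  have h11 := fullTie_mem_openConn_self a₁ ω
  have hs1 : ω ∈ (openConn a₁ c : Set (BondConfig (Fin n))) ↔ ω ∈ (openConn c a₁ : Set (BondConfig (Fin n))) :=
    ⟨fun h => SimpleGraph.Reachable.symm h, fun h => SimpleGraph.Reachable.symm h⟩
  have hs2 : ω ∈ (openConn a₂ c : Set (BondConfig (Fin n))) ↔ ω ∈ (openConn c a₂ : Set (BondConfig (Fin n))) :=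
    ⟨fun h => SimpleGraph.Reachable.symm h, fun h => SimpleGraph.Reachable.symm h⟩
  have ht1 : ω ∈ (openConn o a₁ : Set (BondConfig (Fin n))) → ω ∈ (openConn a₁ c : Set (BondConfig (Fin n))) →
      ω ∈ (openConn o c : Set (BondConfig (Fin n))) := fun h h' => SimpleGraph.Reachable.trans h h'
  have ht2 : ω ∈ (openConn o a₂ : Set (BondConfig (Fin n))) → ω ∈ (openConn a₂ c : Set (BondConfig (Fin n))) →
      ω ∈ (openConn o c : Set (BondConfig (Fin n))) := fun h h' => SimpleGraph.Reachable.trans h h'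
  tauto

/-- The gain of `o` from gluing `{a₁, c}` in `w¹`, pulled back:
`μ¹((o↔a₁ ∪ o↔c) ∩ (o↔b)ᶜ ∩ (a₁↔b ∪ c↔b)) = μ(oA ∩ (o↔b)ᶜ ∩ ((o↔a₁ ∪ o↔a₂) ∩ (a₁↔b ∪ a₂↔b))ᶜ ∩ Ab)`. [folklore] -/
theorem twoStep_glue_gain (w : Sym2 (Fin n) → unitInterval) {a₁ a₂ : Fin n} (h12 : a₁ ≠ a₂) (o b c : Fin n) :
    (prodBernoulli (Function.update w s(a₁, a₂) 1)).real
        ((openConn o a₁ ∪ openConn o c) ∩ (openConn o b)ᶜ ∩ (openConn a₁ b ∪ openConn c b)) =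
      (prodBernoulli w).real
        ((openConn o a₁ ∪ openConn o a₂ ∪ openConn o c) ∩ (openConn o b)ᶜ ∩
          ((openConn o a₁ ∪ openConn o a₂) ∩ (openConn a₁ b ∪ openConn a₂ b))ᶜ ∩
          (openConn a₁ b ∪ openConn a₂ b ∪ openConn c b) : Set (BondConfig (Fin n))) := by
  rw [fullTie_real_update_one w h12]
  congr 1
  ext ω
  simp only [Set.mem_setOf_eq, Set.mem_inter_iff, Set.mem_compl_iff, Set.mem_union, twoStep_glueReach_left,
    twoStep_glueReach_right]
  rw [fullTie_glueReach_pair, fullTie_glueReach_pair, fullTie_glueReach_pair]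
  constructor
  · rintro ⟨⟨hO, hOb⟩, hB⟩
    refine ⟨⟨⟨?_, fun h => hOb (Or.inl h)⟩, fun h => hOb (Or.inr h)⟩, ?_⟩
    · rcases hO with hO | hO | hO
      · exact Or.inl hO
      · exact Or.inr hO
      · exact Or.inl hO.1
    · rcases hB with hB | hB | hB
      · exact Or.inl hB
      · exact Or.inr hB
      · exact Or.inl hB.2
  · rintro ⟨⟨⟨hO, hOb⟩, hX⟩, hB⟩
    refine ⟨⟨?_, ?_⟩, ?_⟩
    · rcases hO with hO | hO
      · exact Or.inl hO
      · exact Or.inr (Or.inl hO)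
    · rintro (h | h)
      · exact hOb h
      · exact hX h
    · rcases hB with hB | hB
      · exact Or.inl hB
      · exact Or.inr (Or.inl hB)

/-- `μ¹((o↔a₁ ∪ o↔c) ∩ c↔b ∩ (a₁↔b)ᶜ) = μ(oA ∩ c↔b ∩ (a₁↔b ∪ a₂↔b)ᶜ)`. [folklore] -/
theorem twoStep_glue_Tc (w : Sym2 (Fin n) → unitInterval) {a₁ a₂ : Fin n} (h12 : a₁ ≠ a₂) (o b c : Fin n) :
    (prodBernoulli (Function.update w s(a₁, a₂) 1)).real
        ((openConn o a₁ ∪ openConn o c) ∩ openConn c b ∩ (openConn a₁ b)ᶜ) =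
      (prodBernoulli w).real
        ((openConn o a₁ ∪ openConn o a₂ ∪ openConn o c) ∩ openConn c b ∩ (openConn a₁ b ∪ openConn a₂ b)ᶜ :
          Set (BondConfig (Fin n))) := by
  rw [fullTie_real_update_one w h12]
  congr 1
  ext ω
  simp only [Set.mem_setOf_eq, Set.mem_inter_iff, Set.mem_compl_iff, Set.mem_union, twoStep_glueReach_left,
    twoStep_glueReach_right]
  rw [fullTie_glueReach_pair, fullTie_glueReach_pair]
  constructor
  · rintro ⟨⟨hO, hB⟩, hnB⟩
    refine ⟨⟨?_, ?_⟩, hnB⟩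
    · rcases hO with hO | hO | hO
      · exact Or.inl hO
      · exact Or.inr hO
      · exact Or.inl hO.1
    · rcases hB with hB | hB
      · exact hB
      · exact absurd hB.2 hnB
  · rintro ⟨⟨hO, hB⟩, hnB⟩
    refine ⟨⟨?_, Or.inl hB⟩, hnB⟩
    rcases hO with hO | hO
    · exact Or.inl hO
    · exact Or.inr (Or.inl hO)

/-- `μ¹((o↔a₁ ∪ o↔c) ∩ a₁↔b ∩ (c↔b)ᶜ) = μ(oA ∩ (a₁↔b ∪ a₂↔b) ∩ (c↔b)ᶜ ∩ N)`. [folklore] -/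
theorem twoStep_glue_Ta (w : Sym2 (Fin n) → unitInterval) {a₁ a₂ : Fin n} (h12 : a₁ ≠ a₂) (o b c : Fin n) :
    (prodBernoulli (Function.update w s(a₁, a₂) 1)).real
        ((openConn o a₁ ∪ openConn o c) ∩ openConn a₁ b ∩ (openConn c b)ᶜ) =
      (prodBernoulli w).real
        ((openConn o a₁ ∪ openConn o a₂ ∪ openConn o c) ∩ (openConn a₁ b ∪ openConn a₂ b) ∩ (openConn c b)ᶜ ∩
          ((openConn c a₁)ᶜ ∩ (openConn c a₂)ᶜ) : Set (BondConfig (Fin n))) := by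
  rw [fullTie_real_update_one w h12]
  congr 1
  ext ω
  simp only [Set.mem_setOf_eq, Set.mem_inter_iff, Set.mem_compl_iff, Set.mem_union, twoStep_glueReach_left,
    twoStep_glueReach_right]
  rw [fullTie_glueReach_pair, fullTie_glueReach_pair]
  constructor
  · rintro ⟨⟨hO, hB⟩, hnB⟩
    refine ⟨⟨⟨?_, hB⟩, fun h => hnB (Or.inl h)⟩, ⟨fun h => hnB (Or.inr ⟨Or.inl h, hB⟩),
      fun h => hnB (Or.inr ⟨Or.inr h, hB⟩)⟩⟩
    rcases hO with hO | hO | hO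
    · exact Or.inl hO
    · exact Or.inr hO
    · exact Or.inl hO.1
  · rintro ⟨⟨⟨hO, hB⟩, hnB⟩, ⟨hn1, hn2⟩⟩
    refine ⟨⟨?_, hB⟩, ?_⟩
    · rcases hO with hO | hO
      · exact Or.inl hO
      · exact Or.inr (Or.inl hO)
    · rintro (h | ⟨h | h, -⟩)
      · exact hnB h
      · exact hn1 h
      · exact hn2 h

end GluePair

/-! ### An identity behind the weighted form -/

/-- For any measure: `μ(E) − μ(F_x) = T_y − Gain`, with `E = o↔b ∩ (o↔x ∪ o↔y)`, `F_x = (o↔x ∪ o↔y) ∩ x↔b`,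
`T_y = μ((o↔x ∪ o↔y) ∩ y↔b ∩ (x↔b)ᶜ)`, `Gain = μ((o↔x ∪ o↔y) ∩ (o↔b)ᶜ ∩ (x↔b ∪ y↔b))`. [folklore] -/
theorem twoStep_EF_identity (u : Sym2 (Fin n) → unitInterval) (o b x y : Fin n) :
    (prodBernoulli u).real (openConn o b ∩ (openConn o x ∪ openConn o y)) -
        (prodBernoulli u).real ((openConn o x ∪ openConn o y) ∩ openConn x b) =
      (prodBernoulli u).real ((openConn o x ∪ openConn o y) ∩ openConn y b ∩ (openConn x b)ᶜ) -
        (prodBernoulli u).real ((openConn o x ∪ openConn o y) ∩ (openConn o b)ᶜ ∩ (openConn x b ∪ openConn y b)) := by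
  set μ := prodBernoulli u with hμ
  set OB : Set (BondConfig (Fin n)) := (openConn o x ∪ openConn o y) ∩ (openConn x b ∪ openConn y b) with hOB
  have hm : ∀ s : Set (BondConfig (Fin n)), MeasurableSet s := fun _ => MeasurableSet.of_discrete
  have h1 := measureReal_inter_add_sdiff (μ := μ) (s := OB) (hm (openConn o b))
  have h2 := measureReal_inter_add_sdiff (μ := μ) (s := OB) (hm (openConn x b))
  have e1 : OB ∩ openConn o b = openConn o b ∩ (openConn o x ∪ openConn o y) := by
    ext ω
    simp only [hOB, Set.mem_inter_iff, Set.mem_union]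
    constructor
    · rintro ⟨⟨hO, -⟩, hb⟩
      exact ⟨hb, hO⟩
    · rintro ⟨hb, hO⟩
      refine ⟨⟨hO, ?_⟩, hb⟩
      rcases hO with h | h
      · exact Or.inl (SimpleGraph.Reachable.trans (SimpleGraph.Reachable.symm h) hb)
      · exact Or.inr (SimpleGraph.Reachable.trans (SimpleGraph.Reachable.symm h) hb)
  have e2 : OB \ openConn o b = (openConn o x ∪ openConn o y) ∩ (openConn o b)ᶜ ∩ (openConn x b ∪ openConn y b) := by
    ext ω
    simp only [hOB, Set.mem_sdiff, Set.mem_inter_iff, Set.mem_compl_iff]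
    tauto
  have e3 : OB ∩ openConn x b = (openConn o x ∪ openConn o y) ∩ openConn x b := by
    ext ω
    simp only [hOB, Set.mem_inter_iff, Set.mem_union]
    tauto
  have e4 : OB \ openConn x b = (openConn o x ∪ openConn o y) ∩ openConn y b ∩ (openConn x b)ᶜ := by
    ext ω
    simp only [hOB, Set.mem_sdiff, Set.mem_inter_iff, Set.mem_union, Set.mem_compl_iff]
    tauto
  rw [e1, e2] at h1
  rw [e3, e4] at h2
  linarith

end

end Summit.CriticalPhenomena.PercolationContinuityZ3.Theorems
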